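import Mathlib
import Literature.MathematicalPhysics.QuantumFieldTheory.PottsGaugeWilsonLoopTopology
import Literature.MathematicalPhysics.QuantumFieldTheory.PlaquetteRandomClusterComparison
import HarnessLib

/-!
# Wilson loop expectations of `q`-state Potts lattice gauge theory are sandwiched between
# Bernoulli plaquette-percolation surface probabilities (Duncan–Schweinhart, CMP 406 (2025), §5.5) — PROVED

Seventh file of the transcription of the Fortuin–Kasteleyn-type representation of `q`-state Potts
lattice gauge theory (companions: `PlaquetteRandomCluster` — setting, readings, SCOPE caveat:
`ℤ_q`/Potts gauge theory only, nothing here bears on the Yang–Mills mass gap or on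
`BalabanLadder.IR`; in the `ym` ladder only the conditional finite-`𝕋⁴` rung `BalabanLadder.UV` is
closed by any route —, `PottsGaugeEdwardsSokal`, `PottsGaugeWilsonLoopTopology` (Theorem 5),
`PlaquetteRandomClusterComparison` (Lemma 32, Bernoulli sandwich)).

Source: P. Duncan, B. Schweinhart, *Topological phases in the plaquette random-cluster model and
Potts lattice gauge theory*, Comm. Math. Phys. **406** (2025), arXiv:2207.08339
[DuncanSchweinhart2025], §5.5 (proof of Theorem 7): "By Theorem 5, a sharp phase transition for
Wilson loop variables is equivalent to one for the topological variables `V_γ` … We can, however,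
show a partial result by comparison to plaquette percolation": Theorem 5 (`𝔼_ν(W_γ) = μ_{p,q}(V_γ)`,
`p = 1 - e^{-β}`) combined with Lemma 32 (`ψ_{p̂} ≤_st μ_{p,q} ≤_st ψ_p`, `ψ_r` = Bernoulli plaquette
percolation = the `q = 1` model, `p̂ = (p/q)/(1 - p + p/q)`) and the monotonicity of the event `V_γ`
gives `ψ_{p̂}(V_γ) ≤ 𝔼_ν(W_γ) ≤ ψ_p(V_γ)` — the rigorous form, for Potts gauge theories, of the
Aizenman–Chayes–Chayes–Fröhlich–Russo (1983) programme relating Wilson loops to surfaces of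
independent plaquettes. The remaining input of Theorem 7 (area/perimeter laws for Bernoulli
plaquette percolation on `ℤ^d`, ACCFR Theorem 34 there) is an infinite-volume statement not typed
here. Everything below is on the finite torus `𝕋^d_L`, `i = 2`, prime `q`, and PROVED.

## Main statements (all PROVED; no named fact)

* `IsNullHomologousIn.mono`, `isUpperSet_nullHomologous` — `V_γ` is an increasing event;
* `eventProb_sandwich` — for an increasing event `E`, `p ∈ (0,1)`, `q ≥ 1`:
  `ψ_{p̂}(E) ≤ μ_{p,q}(E) ≤ ψ_p(E)`;
* `wilsonLoop_percolation_sandwich` — for prime `q`, `β > 0` and any `1`-chain `γ`: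
  `ψ_{p̂}(V_γ) ≤ 𝔼_{ν_β}(W_γ) ≤ ψ_{p}(V_γ)` with `p = 1 - e^{-β}`, `p̂ = (e^β - 1)/(e^β - 1 + q)`
  (`hatParam_esParam`).
-/

open Finset

namespace Literature.MathematicalPhysics.QuantumFieldTheory

namespace PlaquetteRC

open LatticeForm

variable {d L : ℕ} [NeZero L]

/-! ### `V_γ` is an increasing event -/

/-- Opening more plaquettes preserves null-homology: `V_γ` is increasing in `ω`.
[cite: DuncanSchweinhart2025, §5.5 (proof of Thm. 7)] -/
theorem IsNullHomologousIn.mono {R : Type*} [CommRing R] {ω ω' : Finset (Plaquette d L)}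
    (h : ω ⊆ ω') {γ : Site d L → Fin d → R} (hγ : IsNullHomologousIn ω γ) :
    IsNullHomologousIn ω' γ := by
  obtain ⟨c, hc, hcγ⟩ := hγ
  exact ⟨c, fun σ hσ => hc σ (fun h' => hσ (h h')), hcγ⟩

/-- `{ω : V_γ(ω)}` is an upper set of configurations. [cite: DuncanSchweinhart2025, §5.5 (proof of Thm. 7)] -/
theorem isUpperSet_nullHomologous {R : Type*} [CommRing R] (γ : Site d L → Fin d → R) :
    IsUpperSet {ω : Finset (Plaquette d L) | IsNullHomologousIn ω γ} :=
  fun _ _ hle hω => IsNullHomologousIn.mono hle hω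

/-! ### Event probabilities under the Bernoulli sandwich -/

section Sandwich

variable (F : Type*) [Field F]

open Classical in
/-- `μ(E)` is the expectation of the indicator of `E`. [cite: DuncanSchweinhart2025, §1.1 Def. 1] -/
theorem eventProb_eq_expect (p q : ℝ) (E : Set (Finset (Plaquette d L))) :
    eventProb F p q E = expect F p q (fun ω => if ω ∈ E then 1 else 0) := by
  unfold eventProb expect
  refine Finset.sum_congr rfl fun ω _ => ?_
  by_cases hω : ω ∈ E <;> simp [hω]

/-- **The Bernoulli sandwich for increasing events**: `ψ_{p̂}(E) ≤ μ_{p,q}(E) ≤ ψ_p(E)` for every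
increasing event `E`, `p ∈ (0,1)`, `q ≥ 1` (Lemma 32 with `q' = 1`, applied to indicators).
[cite: DuncanSchweinhart2025, Lemma 32 and §5.5] -/
theorem eventProb_sandwich {p q : ℝ} (hp : p ∈ Set.Ioo (0 : ℝ) 1) (hq : 1 ≤ q)
    {E : Set (Finset (Plaquette d L))} (hE : IsUpperSet E) :
    eventProb F (hatParam p q) 1 E ≤ eventProb F p q E ∧ eventProb F p q E ≤ eventProb F p 1 E := by
  classical
  have h0 : (0 : Finset (Plaquette d L) → ℝ) ≤ fun ω => if ω ∈ E then 1 else 0 := by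
    intro ω; simp only [Pi.zero_apply]; split_ifs <;> norm_num
  have hmono : Monotone (fun ω : Finset (Plaquette d L) => if ω ∈ E then (1 : ℝ) else 0) := by
    intro a b hab
    simp only
    by_cases ha : a ∈ E
    · rw [if_pos ha, if_pos (hE hab ha)]
    · rw [if_neg ha]; split_ifs <;> norm_num
  rw [eventProb_eq_expect, eventProb_eq_expect, eventProb_eq_expect]
  exact ⟨expect_bernoulli_hat_le_expect F hp hq h0 hmono, expect_le_expect_bernoulli F hp hq h0 hmono⟩

end Sandwich

/-! ### The sandwich for Wilson loops -/

section Wilson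

variable (q : ℕ) [Fact q.Prime]

/-- For `β > 0` the coupling parameter `p = 1 - e^{-β}` lies in `(0,1)`. [cite: DuncanSchweinhart2025, Prop. 20] -/
theorem esParam_mem_Ioo {β : ℝ} (hβ : 0 < β) : esParam β ∈ Set.Ioo (0 : ℝ) 1 := by
  constructor
  · simp only [esParam, sub_pos]
    exact Real.exp_lt_one_iff.mpr (by linarith)
  · simp only [esParam]; linarith [Real.exp_pos (-β)]

/-- `p̂(1 - e^{-β}, q) = (e^β - 1)/(e^β - 1 + q)`. [cite: DuncanSchweinhart2025, Lemma 32 (p̂)] -/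
theorem hatParam_esParam (β q' : ℝ) :
    hatParam (esParam β) q' = (Real.exp β - 1) / (Real.exp β - 1 + q') := by
  unfold hatParam esParam
  have hβ : Real.exp (-β) = (Real.exp β)⁻¹ := Real.exp_neg β
  have hpos : Real.exp β ≠ 0 := (Real.exp_pos β).ne'
  rw [hβ]
  field_simp
  ring

/-- **Wilson loops between plaquette-percolation surface probabilities (Duncan–Schweinhart §5.5),
PROVED on the torus.** For a prime `q`, `β > 0` and any `ℤ_q` `1`-chain `γ`, the `q`-state Potts
lattice gauge expectation of the Wilson loop variable satisfies
`ψ_{p̂}(V_γ) ≤ 𝔼_{ν_β}(W_γ) ≤ ψ_p(V_γ)`, where `ψ_r` is Bernoulli plaquette percolation with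
density `r` (the `q = 1` plaquette random-cluster model), `V_γ` the event that `γ` bounds a
`ℤ_q`-surface of open plaquettes, `p = 1 - e^{-β}` and `p̂ = (e^β - 1)/(e^β - 1 + q)`.
[cite: DuncanSchweinhart2025, §5.5 (proof of Thm. 7: Thm. 5 + comparison with plaquette percolation)] -/
theorem wilsonLoop_percolation_sandwich {β : ℝ} (hβ : 0 < β) (γ : Site d L → Fin d → ZMod q) :
    eventProb (d := d) (L := L) (ZMod q) (hatParam (esParam β) q) 1 {ω | IsNullHomologousIn ω γ} ≤
        (pottsExpect (d := d) (L := L) (ZMod q) β (wilsonLoopVar q γ)).re ∧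
      (pottsExpect (d := d) (L := L) (ZMod q) β (wilsonLoopVar q γ)).re ≤
        eventProb (d := d) (L := L) (ZMod q) (esParam β) 1 {ω | IsNullHomologousIn ω γ} := by
  have hq : (1 : ℝ) ≤ q := by exact_mod_cast (Fact.out : q.Prime).one_lt.le
  have h := eventProb_sandwich (d := d) (L := L) (ZMod q) (esParam_mem_Ioo hβ) hq
    (isUpperSet_nullHomologous (R := ZMod q) γ)
  rw [pottsExpect_wilsonLoopVar_eq_eventProb, Complex.ofReal_re]
  exact h

end Wilson

end PlaquetteRC

end Literature.MathematicalPhysics.QuantumFieldTheory
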